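import Summits.QuantumFields.QCD.Theorems.ExtinctionBuildsQCD.Negative.WithoutTightCollapse

/-!
# Torus toolkit for stub `stub_detQuasilocal` (S3) of line `free-volume-heavy-witness`
(crux `SpectralDefectExtinction.WindowExtinction`, item stmt-QuantumFields-8964)

Configuration-wise facts about the tree's Wilson–Dirac matrix `D_W(U, m, 1) = wilsonDirac ρ U m 1`
(unitary colour representation `ρ`, periodic torus `(ℤ/n)⁴`, ANY gauge field) behind the
quasi-locality of `log |det D_W|`:

* `detQL_exists_coord_far` — two boxes whose centres are `≥ R₁ + R₂ + D` apart from every periodic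
  image of each other have torus images that are `≥ D` apart in the cyclic distance of SOME
  coordinate;
* `detQL_wilsonDirac_apply_congr`, `detQL_wilsonDirac_sub_apply_eq_zero` — an entry `D_W(p,q)` only
  sees the links leaving the sites `p.1, q.1`, so a change of the field inside a site set `S`
  changes `D_W` only on `T × T`, `T` = `S` plus its neighbours (`detQL_box_image_closure`: for `S`
  the image of `c + [-R,R]⁴` one may take `T` the image of `c + [-R-1,R+1]⁴`;
  `detQL_card_boxIndex_le`: at most `12 (2R+3)⁴` fermion indices);
* `detQL_wilsonDirac_mixed_eq_zero` — `D_W` is affine in each link: four fields pairing off link by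
  link have vanishing mixed second difference `D₁₂ − D₁ − D₂ + D₀ = 0`;
* `detQL_isUnit_det_wilsonDirac_and_norm_inv_le` — for `m > 0`, `D_W(m) = (m+4)(1 − x)` with
  `‖x‖ ≤ 4/(m+4)` (HJL (2.14)), so `D_W(m)` is invertible with `‖D_W(m)⁻¹‖ ≤ 1/m` (Neumann series,
  as in the tree's `norm_inv_wilsonDirac_apply_le`);
* `detQL_norm_sandwich_le` — DECAY: if the columns of `V₂` live in `T₂`, the rows of `V₁` in `T₁`,
  and `T₂, T₁` are `d`-separated, then `V₂ D_W(m)⁻¹ V₁ = V₂ x^d D_W(m)⁻¹ V₁` (the first `d` hopping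
  terms do not connect `T₂` to `T₁`, tree `pow_apply_eq_zero_of_lt_valMinAbs`), whence
  `‖V₂ D_W⁻¹ V₁ G'‖ ≤ ‖V₂‖ (4/(lo+4))^d lo⁻¹ ‖V₁‖ ‖G'‖`;
* `detQL_norm_wilsonDirac_sub_le` (`‖D_W(X) − D_W(Y)‖ ≤ 8`), `detQL_norm_eigenvalue_le_opNorm`;
* `stub_detQuasilocal_propagatorBound` — the `SU(3)` propagator bound, the registered sub-goal
  (`workitem stub-add`) under which this toolkit file lands `--supports` the crux item.

No definitions; pure theorem file serving the lead's skeleton `work/WindowExtinction.lean`.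
-/

noncomputable section

namespace Summit.QuantumFields.QCD.Cruxes.WindowExtinction.FreeVolumeHeavyWitness

open Literature.MathematicalPhysics.QuantumLattice Literature.MathematicalPhysics.QuantumFieldTheory
  Literature.Probability.LatticeModels
open MeasureTheory Matrix Filter Literature.MathematicalPhysics
open scoped BigOperators Matrix.Norms.L2Operator

section Torus

variable {n N : ℕ} {G : Type*} [Group G] (ρ : G →* Matrix (Fin N) (Fin N) ℂ)

/-- **Separated boxes stay separated on the torus.**  If the centres `c₁, c₂` are at sup-distance
`≥ R₁ + R₂ + D` from every periodic image of each other, then for `y_i ∈ box R_i` the torus points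
`proj (c₂ + y₂)` and `proj (c₁ + y₁)` have cyclic distance `≥ D` in some coordinate. -/
theorem detQL_exists_coord_far [NeZero n] (c₁ c₂ : Fin 4 → ℤ) (R₁ R₂ D : ℕ)
    (hsep : ∀ q : Fin 4 → ℤ, ∃ j : Fin 4, ((R₁ + R₂ + D : ℕ) : ℤ) ≤ |c₁ j - c₂ j - q j * n|)
    {y₁ y₂ : Fin 4 → ℤ} (hy₁ : y₁ ∈ box 4 R₁) (hy₂ : y₂ ∈ box 4 R₂) :
    ∃ j : Fin 4,
      D ≤ ((Torus.proj n (c₂ + y₂)) j - (Torus.proj n (c₁ + y₁)) j).valMinAbs.natAbs := by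
  by_contra hcon
  push Not at hcon
  have hdvd : ∀ j, (n : ℤ) ∣ (c₂ j + y₂ j - (c₁ j + y₁ j)) -
      ((Torus.proj n (c₂ + y₂)) j - (Torus.proj n (c₁ + y₁)) j).valMinAbs := by
    intro j
    rw [← ZMod.intCast_zmod_eq_zero_iff_dvd]
    push_cast
    simp only [Torus.proj_apply, Pi.add_apply, Int.cast_add, sub_self]
  choose q hq using hdvd
  obtain ⟨j, hj⟩ := hsep (fun j => -q j)
  have h1 := hq j
  have h2 := hcon j
  rw [mem_box] at hy₁ hy₂
  have h3 := hy₁ j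
  have h4 := hy₂ j
  push_cast at hj h3 h4
  have h5 : c₁ j - c₂ j - -q j * (n : ℤ) =
      y₂ j - y₁ j - ((Torus.proj n (c₂ + y₂)) j - (Torus.proj n (c₁ + y₁)) j).valMinAbs := by
    linarith
  rw [h5, Int.abs_eq_natAbs] at hj
  omega

/-- Entries of the Wilson operator depend on the gauge field only through the links leaving the
row site and the column site. -/
theorem detQL_wilsonDirac_apply_congr (X Y : GaugeConfig 4 n G) (m r : ℝ)
    (p q : TorusSite 4 n × Fin N × Fin 4) (hp : ∀ μ, X (p.1, μ) = Y (p.1, μ))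
    (hq : ∀ μ, X (q.1, μ) = Y (q.1, μ)) : wilsonDirac ρ X m r p q = wilsonDirac ρ Y m r p q := by
  simp only [wilsonDirac, Matrix.of_apply, hp, hq]

/-- **Support of a local change of the Wilson operator.**  If `X` and `Y` agree on every link not
leaving the site set `S`, and `T ⊇ S` contains all neighbours of `S`, then `D_W(X) − D_W(Y)` is
supported in `T × T`. -/
theorem detQL_wilsonDirac_sub_apply_eq_zero (X Y : GaugeConfig 4 n G) (m r : ℝ)
    (S T : TorusSite 4 n → Prop) (hXY : ∀ e : TorusSite 4 n × Fin 4, ¬ S e.1 → X e = Y e)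
    (hT0 : ∀ x, S x → T x) (hT1 : ∀ x μ, S x → T (QuantumFieldTheory.Site.shift x μ))
    (hT2 : ∀ x μ, S (QuantumFieldTheory.Site.shift x μ) → T x)
    (p q : TorusSite 4 n × Fin N × Fin 4) (hpq : ¬ (T p.1 ∧ T q.1)) :
    (wilsonDirac ρ X m r - wilsonDirac ρ Y m r) p q = 0 := by
  rw [Matrix.sub_apply, sub_eq_zero]
  by_cases hnear : p.1 = q.1 ∨ ∃ μ, q.1 = QuantumFieldTheory.Site.shift p.1 μ ∨
      p.1 = QuantumFieldTheory.Site.shift q.1 μ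
  · have hp : ¬ S p.1 := by
      intro h
      refine hpq ⟨hT0 _ h, ?_⟩
      rcases hnear with h0 | ⟨μ, h1 | h2⟩
      · exact h0 ▸ hT0 _ h
      · exact h1 ▸ hT1 _ μ h
      · exact hT2 _ μ (h2 ▸ h)
    have hq : ¬ S q.1 := by
      intro h
      refine hpq ⟨?_, hT0 _ h⟩
      rcases hnear with h0 | ⟨μ, h1 | h2⟩
      · exact h0 ▸ hT0 _ (h0 ▸ h)
      · exact hT2 _ μ (h1 ▸ h)
      · exact h2 ▸ hT1 _ μ h
    exact detQL_wilsonDirac_apply_congr ρ X Y m r p q (fun μ => hXY _ hp) (fun μ => hXY _ hq)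
  · simp only [not_or, not_exists] at hnear
    rw [wilsonDirac_apply_eq_zero_of_far ρ X m r hnear.1 (fun μ => (hnear.2 μ).1)
        (fun μ => (hnear.2 μ).2),
      wilsonDirac_apply_eq_zero_of_far ρ Y m r hnear.1 (fun μ => (hnear.2 μ).1)
        (fun μ => (hnear.2 μ).2)]

/-- **The Wilson operator is affine in each link**: for four gauge fields which, link by link,
pair off as `(W₁ = W₂ ∧ W₃ = W₄)` or `(W₁ = W₃ ∧ W₂ = W₄)`, the mixed second difference
`D_W(W₁) − D_W(W₂) − D_W(W₃) + D_W(W₄)` vanishes. -/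
theorem detQL_wilsonDirac_mixed_eq_zero (W₁ W₂ W₃ W₄ : GaugeConfig 4 n G) (m r : ℝ)
    (hE : ∀ e, (W₁ e = W₂ e ∧ W₃ e = W₄ e) ∨ (W₁ e = W₃ e ∧ W₂ e = W₄ e)) :
    wilsonDirac ρ W₁ m r - wilsonDirac ρ W₂ m r - wilsonDirac ρ W₃ m r + wilsonDirac ρ W₄ m r =
      0 := by
  have key : ∀ (f : G → ℂ) (e : TorusSite 4 n × Fin 4),
      f (W₁ e) - f (W₂ e) - f (W₃ e) + f (W₄ e) = 0 := by
    intro f e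
    rcases hE e with ⟨h1, h2⟩ | ⟨h1, h2⟩ <;> rw [h1, h2] <;> ring
  ext p q
  simp only [Matrix.sub_apply, Matrix.add_apply, Matrix.zero_apply, wilsonDirac, Matrix.of_apply]
  have hlin : ∀ (a b t₁ t₂ t₃ t₄ : ℂ), t₁ - t₂ - t₃ + t₄ = 0 →
      (a - b * t₁) - (a - b * t₂) - (a - b * t₃) + (a - b * t₄) = 0 := by
    intro a b t₁ t₂ t₃ t₄ h
    linear_combination -b * h
  apply hlin
  rw [← Finset.sum_sub_distrib, ← Finset.sum_sub_distrib, ← Finset.sum_add_distrib]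
  refine Finset.sum_eq_zero fun μ _ => ?_
  have k1 := key (fun g => if q.1 = QuantumFieldTheory.Site.shift p.1 μ then
      (((r : ℂ) • (1 : Matrix (Fin 4) (Fin 4) ℂ)) p.2.2 q.2.2 - euclideanGamma μ p.2.2 q.2.2) *
        ρ g p.2.1 q.2.1 else 0) (p.1, μ)
  have k2 := key (fun g => if p.1 = QuantumFieldTheory.Site.shift q.1 μ then
      (((r : ℂ) • (1 : Matrix (Fin 4) (Fin 4) ℂ)) p.2.2 q.2.2 + euclideanGamma μ p.2.2 q.2.2) *
        ρ g⁻¹ p.2.1 q.2.1 else 0) (q.1, μ)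
  linear_combination k1 + k2

/-- Rows: if row `i` of `A` vanishes then row `i` of `A * B` vanishes. -/
theorem detQL_mul_apply_eq_zero_of_row {ι : Type*} [Fintype ι] {A B : Matrix ι ι ℂ} {i : ι}
    (h : ∀ r, A i r = 0) (j : ι) : (A * B) i j = 0 := by
  rw [Matrix.mul_apply]
  exact Finset.sum_eq_zero fun r _ => by rw [h r, zero_mul]

/-- **Sandwich vanishing**: if the columns of `V₂` live in `T₂`, the rows of `V₁` live in `T₁`
and `F` has no entries from `T₂` to `T₁`, then `V₂ F V₁ = 0`. -/
theorem detQL_sandwich_eq_zero {ι : Type*} [Fintype ι] (V₂ F V₁ : Matrix ι ι ℂ) (T₁ T₂ : ι → Prop)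
    (hV₂ : ∀ i j, ¬ T₂ j → V₂ i j = 0) (hV₁ : ∀ i j, ¬ T₁ i → V₁ i j = 0)
    (hF : ∀ r t, T₂ r → T₁ t → F r t = 0) : V₂ * F * V₁ = 0 := by
  ext i j
  rw [Matrix.mul_apply, Matrix.zero_apply]
  refine Finset.sum_eq_zero fun t _ => ?_
  by_cases ht : T₁ t
  · rw [Matrix.mul_apply, Finset.sum_eq_zero, zero_mul]
    intro r _
    by_cases hr : T₂ r
    · rw [hF r t hr ht, mul_zero]
    · rw [hV₂ i r hr, zero_mul]
  · rw [hV₁ t j ht, mul_zero]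

/-- **Finite range of the hopping tail between separated sets.**  For a nearest-neighbour matrix
`X` on the torus, if every `T₂`-site is at cyclic distance `≥ d` (in some coordinate) from every
`T₁`-site, then `Σ_{k<d} X^k` has no entries from `T₂` to `T₁`. -/
theorem detQL_sum_pow_apply_eq_zero [NeZero n]
    {X : Matrix (TorusSite 4 n × Fin N × Fin 4) (TorusSite 4 n × Fin N × Fin 4) ℂ}
    (hX : ∀ p q : TorusSite 4 n × Fin N × Fin 4,
      ¬ (p.1 = q.1 ∨ ∃ μ, q.1 = QuantumFieldTheory.Site.shift p.1 μ ∨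
          p.1 = QuantumFieldTheory.Site.shift q.1 μ) → X p q = 0)
    (T₁ T₂ : TorusSite 4 n × Fin N × Fin 4 → Prop) (d : ℕ)
    (hfar : ∀ r t, T₂ r → T₁ t → ∃ i : Fin 4, d ≤ (r.1 i - t.1 i).valMinAbs.natAbs)
    (r t : TorusSite 4 n × Fin N × Fin 4) (hr : T₂ r) (ht : T₁ t) :
    (∑ k ∈ Finset.range d, X ^ k) r t = 0 := by
  obtain ⟨i, hi⟩ := hfar r t hr ht
  rw [Matrix.sum_apply]
  exact Finset.sum_eq_zero fun k hk =>
    pow_apply_eq_zero_of_lt_valMinAbs hX i k r t ((Finset.mem_range.1 hk).trans_le hi)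

/-- **Heavy-mass propagator in operator norm** (Neumann series): for `m > 0` the Wilson operator
`D_W(m) = (m+4)(1 − x)`, `‖x‖ ≤ 4/(m+4) < 1`, is invertible with `‖D_W(m)⁻¹‖ ≤ 1/m`, on every
torus and for every gauge field. -/
theorem detQL_isUnit_det_wilsonDirac_and_norm_inv_le [NeZero n]
    (hρ : ∀ g, ρ g ∈ Matrix.unitaryGroup (Fin N) ℂ) (Z : GaugeConfig 4 n G) {m : ℝ} (hm : 0 < m) :
    IsUnit (wilsonDirac ρ Z m 1).det ∧ ‖(wilsonDirac ρ Z m 1)⁻¹‖ ≤ m⁻¹ := by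
  -- adapted from Literature `norm_inv_wilsonDirac_apply_le` (WilsonPropagatorHeavyMass)
  set c : ℝ := m + 4 with hcdef
  have hc : 0 < c := by rw [hcdef]; linarith
  set θ : ℝ := 4 / c with hθ
  have hθ1 : θ < 1 := by rw [hθ, div_lt_one hc, hcdef]; linarith
  set x : Matrix (TorusSite 4 n × Fin N × Fin 4) (TorusSite 4 n × Fin N × Fin 4) ℂ :=
    1 - ((c : ℝ) : ℂ)⁻¹ • wilsonDirac ρ Z m 1 with hx
  have hxn : ‖x‖ ≤ θ := norm_one_sub_smul_wilsonDirac_le ρ hρ Z m hc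
  have hxn1 : ‖x‖ < 1 := hxn.trans_lt hθ1
  set S : Matrix (TorusSite 4 n × Fin N × Fin 4) (TorusSite 4 n × Fin N × Fin 4) ℂ := ∑' k, x ^ k
    with hSdef
  have hS1 : (1 - x) * S = 1 := mul_neg_geom_series x hxn1
  have hc' : ((c : ℝ) : ℂ) ≠ 0 := by exact_mod_cast hc.ne'
  have hD : wilsonDirac ρ Z m 1 = ((c : ℝ) : ℂ) • (1 - x) := by
    rw [hx, sub_sub_cancel, smul_smul, mul_inv_cancel₀ hc', one_smul]
  have hinv : wilsonDirac ρ Z m 1 * (((c : ℝ) : ℂ)⁻¹ • S) = 1 := by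
    rw [hD, smul_mul_smul_comm, mul_inv_cancel₀ hc', one_smul, hS1]
  refine ⟨Matrix.isUnit_det_of_right_inverse hinv, ?_⟩
  rw [Matrix.inv_eq_right_inv hinv, norm_smul, norm_inv, Complex.norm_real, Real.norm_eq_abs,
    abs_of_pos hc]
  have hSnorm : ‖S‖ ≤ (1 - θ)⁻¹ := by
    refine (tsum_geometric_le_of_norm_lt_one x hxn1).trans ?_
    have h1 := l2_opNorm_torusFermion_one_le (L := n) (N := N)
    have h2 : (1 - ‖x‖)⁻¹ ≤ (1 - θ)⁻¹ := inv_anti₀ (by linarith) (by linarith)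
    linarith
  calc c⁻¹ * ‖S‖ ≤ c⁻¹ * (1 - θ)⁻¹ := by gcongr
    _ = m⁻¹ := by rw [hθ, hcdef]; exact heavy_prefactor_eq hm

/-- **Decay of the propagator between separated sets, sandwich form.**  If the columns of `V₂`
live in `T₂`, the rows of `V₁` live in `T₁`, `T₂` and `T₁` are `d`-separated in some cyclic
coordinate, `‖V₁‖, ‖V₂‖ ≤ 8`, `‖G'‖ ≤ 1/lo` and `0 < lo ≤ m`, then
`‖V₂ D_W(Z,m)⁻¹ V₁ G'‖ ≤ 8 · (4/(lo+4))^d · lo⁻¹ · 8 · lo⁻¹`: the first `d` terms of the hopping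
expansion of `D_W⁻¹` do not connect `T₂` to `T₁`. -/
theorem detQL_norm_sandwich_le [NeZero n] (hρ : ∀ g, ρ g ∈ Matrix.unitaryGroup (Fin N) ℂ)
    (Z : GaugeConfig 4 n G) {m lo : ℝ} (hlo : 0 < lo) (hm : lo ≤ m)
    (V₁ V₂ G' : Matrix (TorusSite 4 n × Fin N × Fin 4) (TorusSite 4 n × Fin N × Fin 4) ℂ)
    (T₁ T₂ : TorusSite 4 n × Fin N × Fin 4 → Prop) (d : ℕ)
    (hV₂ : ∀ i j, ¬ T₂ j → V₂ i j = 0) (hV₁ : ∀ i j, ¬ T₁ i → V₁ i j = 0)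
    (hfar : ∀ r t, T₂ r → T₁ t → ∃ i : Fin 4, d ≤ (r.1 i - t.1 i).valMinAbs.natAbs)
    (h2 : ‖V₂‖ ≤ 8) (h1 : ‖V₁‖ ≤ 8) (hG' : ‖G'‖ ≤ lo⁻¹) :
    ‖V₂ * (wilsonDirac ρ Z m 1)⁻¹ * V₁ * G'‖ ≤ 8 * (4 / (lo + 4)) ^ d * lo⁻¹ * 8 * lo⁻¹ := by
  have hm0 : 0 < m := hlo.trans_le hm
  obtain ⟨hunit, hGn⟩ := detQL_isUnit_det_wilsonDirac_and_norm_inv_le ρ hρ Z hm0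
  set D := wilsonDirac ρ Z m 1 with hDdef
  set c : ℝ := m + 4 with hcdef
  have hc : 0 < c := by rw [hcdef]; linarith
  have hc' : ((c : ℝ) : ℂ) ≠ 0 := by exact_mod_cast hc.ne'
  set θ : ℝ := 4 / (lo + 4) with hθ
  have hθ0 : 0 ≤ θ := by positivity
  set x : Matrix (TorusSite 4 n × Fin N × Fin 4) (TorusSite 4 n × Fin N × Fin 4) ℂ :=
    1 - ((c : ℝ) : ℂ)⁻¹ • D with hx
  have hxn : ‖x‖ ≤ θ := by
    refine (norm_one_sub_smul_wilsonDirac_le ρ hρ Z m hc).trans ?_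
    rw [hθ]
    exact div_le_div_of_nonneg_left (by norm_num) (by linarith) (by linarith)
  -- `(1 - x) (c • G) = 1`
  have hS : (1 - x) * (((c : ℝ) : ℂ) • D⁻¹) = 1 := by
    rw [hx, sub_sub_cancel, smul_mul_smul_comm, inv_mul_cancel₀ hc', one_smul,
      Matrix.mul_nonsing_inv _ hunit]
  have htail := geom_series_eq_sum_add_pow_mul hS d
  -- the hopping matrix `x` is nearest-neighbour
  have hNN : ∀ p' q' : TorusSite 4 n × Fin N × Fin 4,
      ¬ (p'.1 = q'.1 ∨ ∃ μ, q'.1 = QuantumFieldTheory.Site.shift p'.1 μ ∨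
          p'.1 = QuantumFieldTheory.Site.shift q'.1 μ) → x p' q' = 0 := by
    intro p' q' h
    have hpq : p' ≠ q' := fun e => h (Or.inl (by rw [e]))
    simp only [not_or, not_exists] at h
    rw [hx, Matrix.sub_apply, Matrix.smul_apply, Matrix.one_apply_ne hpq, hDdef,
      wilsonDirac_apply_eq_zero_of_far ρ Z m 1 h.1 (fun μ => (h.2 μ).1) (fun μ => (h.2 μ).2),
      smul_zero, sub_zero]
  have hvan : V₂ * (∑ k ∈ Finset.range d, x ^ k) * V₁ = 0 :=
    detQL_sandwich_eq_zero V₂ _ V₁ T₁ T₂ hV₂ hV₁ (detQL_sum_pow_apply_eq_zero hNN T₁ T₂ d hfar)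
  have hGeq : V₂ * D⁻¹ * V₁ = V₂ * (x ^ d * D⁻¹) * V₁ := by
    have h3 : D⁻¹ = ((c : ℝ) : ℂ)⁻¹ • (∑ k ∈ Finset.range d, x ^ k) + x ^ d * D⁻¹ := by
      have := congrArg (fun M => ((c : ℝ) : ℂ)⁻¹ • M) htail
      simp only [smul_add, smul_smul, inv_mul_cancel₀ hc', one_smul, mul_smul_comm] at this
      exact this
    conv_lhs => rw [h3]
    rw [Matrix.mul_add, Matrix.add_mul, Matrix.mul_smul, Matrix.smul_mul, hvan, smul_zero, zero_add]
  have hxd : ‖x ^ d * D⁻¹‖ ≤ θ ^ d * lo⁻¹ := by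
    have hG : ‖D⁻¹‖ ≤ lo⁻¹ := hGn.trans (inv_anti₀ hlo hm)
    rcases Nat.eq_zero_or_pos d with h0 | hpos
    · rw [h0, pow_zero, pow_zero, one_mul, one_mul]; exact hG
    · calc ‖x ^ d * D⁻¹‖ ≤ ‖x ^ d‖ * ‖D⁻¹‖ := norm_mul_le _ _
        _ ≤ θ ^ d * lo⁻¹ :=
          mul_le_mul ((norm_pow_le' x hpos).trans (pow_le_pow_left₀ (norm_nonneg _) hxn d)) hG
            (norm_nonneg _) (pow_nonneg hθ0 d)
  rw [hGeq]
  calc ‖V₂ * (x ^ d * D⁻¹) * V₁ * G'‖ ≤ ‖V₂‖ * ‖x ^ d * D⁻¹‖ * ‖V₁‖ * ‖G'‖ := by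
        refine (norm_mul_le _ _).trans ?_
        gcongr
        refine (norm_mul_le _ _).trans ?_
        gcongr
        exact norm_mul_le _ _
    _ ≤ 8 * (θ ^ d * lo⁻¹) * 8 * lo⁻¹ := by gcongr
    _ = 8 * (4 / (lo + 4)) ^ d * lo⁻¹ * 8 * lo⁻¹ := by rw [hθ]; ring

/-- An eigenvalue is bounded by the `ℓ²` operator norm. -/
theorem detQL_norm_eigenvalue_le_opNorm [NeZero n]
    (K : Matrix (TorusSite 4 n × Fin N × Fin 4) (TorusSite 4 n × Fin N × Fin 4) ℂ)
    {v : TorusSite 4 n × Fin N × Fin 4 → ℂ} {z : ℂ} (hv : v ≠ 0) (h : K *ᵥ v = z • v) :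
    ‖z‖ ≤ ‖K‖ := by
  have hle := sum_norm_sq_mulVec_le K v
  rw [h] at hle
  have hsm : ∑ i, ‖(z • v) i‖ ^ 2 = ‖z‖ ^ 2 * ∑ i, ‖v i‖ ^ 2 := by
    rw [Finset.mul_sum]
    exact Finset.sum_congr rfl fun i _ => by rw [Pi.smul_apply, smul_eq_mul, norm_mul, mul_pow]
  rw [hsm] at hle
  have hpos := Summit.QuantumFields.QCD.Theorems.ExtinctionBuildsQCD.Negative.sum_norm_sq_pos hv
  have hsq : ‖z‖ ^ 2 ≤ ‖K‖ ^ 2 := le_of_mul_le_mul_right hle hpos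
  nlinarith [norm_nonneg z, norm_nonneg K]

/-- `‖D_W(X,m) − D_W(Y,m)‖ ≤ 8`: the mass terms cancel and each hopping sum has norm `≤ 4`. -/
theorem detQL_norm_wilsonDirac_sub_le [NeZero n] (hρ : ∀ g, ρ g ∈ Matrix.unitaryGroup (Fin N) ℂ)
    (X Y : GaugeConfig 4 n G) (m : ℝ) : ‖wilsonDirac ρ X m 1 - wilsonDirac ρ Y m 1‖ ≤ 8 := by
  have h4 : ∀ Z : GaugeConfig 4 n G, ‖∑ μ, wilsonHop ρ Z μ‖ ≤ 4 := fun Z =>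
    calc ‖∑ μ : Fin 4, wilsonHop ρ Z μ‖ ≤ ∑ μ : Fin 4, ‖wilsonHop ρ Z μ‖ := norm_sum_le _ _
      _ ≤ ∑ _μ : Fin 4, (1 : ℝ) := Finset.sum_le_sum fun μ _ => l2_opNorm_wilsonHop_le ρ hρ Z μ
      _ = 4 := by simp
  rw [wilsonDirac_eq_sub_sum_wilsonHop ρ hρ X m, wilsonDirac_eq_sub_sum_wilsonHop ρ hρ Y m,
    sub_sub_sub_cancel_left]
  calc ‖∑ μ, wilsonHop ρ Y μ - ∑ μ, wilsonHop ρ X μ‖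
      ≤ ‖∑ μ, wilsonHop ρ Y μ‖ + ‖∑ μ, wilsonHop ρ X μ‖ := norm_sub_le _ _
    _ ≤ 4 + 4 := add_le_add (h4 Y) (h4 X)
    _ = 8 := by norm_num

/-- The box image `proj (c + box R)` sits inside `proj (c + box (R+1))` together with all its
torus neighbours (in both orientations). -/
theorem detQL_box_image_closure (c : Fin 4 → ℤ) (R : ℕ) :
    (∀ x : TorusSite 4 n, (∃ y : ↥(box 4 R), Torus.proj n (c + (y : Fin 4 → ℤ)) = x) →
        ∃ y : ↥(box 4 (R + 1)), Torus.proj n (c + (y : Fin 4 → ℤ)) = x) ∧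
      (∀ (x : TorusSite 4 n) (μ : Fin 4),
        (∃ y : ↥(box 4 R), Torus.proj n (c + (y : Fin 4 → ℤ)) = x) →
        ∃ y : ↥(box 4 (R + 1)),
          Torus.proj n (c + (y : Fin 4 → ℤ)) = QuantumFieldTheory.Site.shift x μ) ∧
      (∀ (x : TorusSite 4 n) (μ : Fin 4),
        (∃ y : ↥(box 4 R), Torus.proj n (c + (y : Fin 4 → ℤ)) = QuantumFieldTheory.Site.shift x μ) →
        ∃ y : ↥(box 4 (R + 1)), Torus.proj n (c + (y : Fin 4 → ℤ)) = x) := by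
  have hmem : ∀ (y : Fin 4 → ℤ) (μ : Fin 4) (t : ℤ), y ∈ box 4 R → |t| ≤ 1 →
      y + Pi.single μ t ∈ box 4 (R + 1) := by
    intro y μ t hy ht
    rw [mem_box] at hy ⊢
    intro i
    have := hy i
    have ht' := abs_le.1 ht
    rw [Pi.add_apply, Pi.single_apply]
    push_cast
    split_ifs <;> constructor <;> linarith
  refine ⟨?_, ?_, ?_⟩
  · rintro x ⟨y, hy⟩
    exact ⟨⟨y, box_mono 4 (Nat.le_succ R) y.2⟩, hy⟩
  · rintro x μ ⟨y, hy⟩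
    refine ⟨⟨(y : Fin 4 → ℤ) + Pi.single μ 1, hmem _ μ 1 y.2 (by norm_num)⟩, ?_⟩
    subst hy
    funext i
    simp only [Torus.proj_apply, Pi.add_apply, QuantumFieldTheory.Site.shift, Pi.single_apply,
      Int.cast_add, Int.cast_ite, Int.cast_one, Int.cast_zero, add_assoc]
  · rintro x μ ⟨y, hy⟩
    refine ⟨⟨(y : Fin 4 → ℤ) + Pi.single μ (-1), hmem _ μ (-1) y.2 (by norm_num)⟩, ?_⟩
    have hx : x = QuantumFieldTheory.Site.shift x μ - Pi.single μ 1 := by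
      rw [QuantumFieldTheory.Site.shift, add_sub_cancel_right]
    rw [hx, ← hy]
    funext i
    simp only [Torus.proj_apply, Pi.add_apply, Pi.sub_apply, Pi.single_apply, Int.cast_add,
      Int.cast_ite, Int.cast_neg, Int.cast_one, Int.cast_zero]
    split_ifs <;> ring

/-- The fermion indices over the box image `proj (c + box R')` number at most `12 (2R'+1)^4`. -/
theorem detQL_card_boxIndex_le [NeZero n] (c : Fin 4 → ℤ) (R' : ℕ) :
    Fintype.card {p : TorusSite 4 n × Fin 3 × Fin 4 //
        ∃ y : ↥(box 4 R'), Torus.proj n (c + (y : Fin 4 → ℤ)) = p.1} ≤ 12 * (2 * R' + 1) ^ 4 := by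
  classical
  set f : (Fin 4 → ℤ) × (Fin 3 × Fin 4) → TorusSite 4 n × Fin 3 × Fin 4 :=
    fun ya => (Torus.proj n (c + ya.1), ya.2) with hf
  rw [Fintype.card_subtype]
  calc (Finset.univ.filter fun p : TorusSite 4 n × Fin 3 × Fin 4 =>
          ∃ y : ↥(box 4 R'), Torus.proj n (c + (y : Fin 4 → ℤ)) = p.1).card
      ≤ ((box 4 R' ×ˢ (Finset.univ : Finset (Fin 3 × Fin 4))).image f).card := by
        refine Finset.card_le_card fun p hp => ?_
        obtain ⟨y, hy⟩ := (Finset.mem_filter.1 hp).2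
        exact Finset.mem_image.2 ⟨(y, p.2), Finset.mem_product.2 ⟨y.2, Finset.mem_univ _⟩,
          by rw [hf]; exact Prod.ext hy rfl⟩
    _ ≤ (box 4 R' ×ˢ (Finset.univ : Finset (Fin 3 × Fin 4))).card := Finset.card_image_le
    _ = 12 * (2 * R' + 1) ^ 4 := by
        rw [Finset.card_product, card_box, Finset.card_univ, Fintype.card_prod, Fintype.card_fin,
          Fintype.card_fin]
        ring

/-- **Registered sub-goal of stub `stub_detQuasilocal` (torus toolkit anchor).**  For every `SU(3)`
gauge field on every torus and every bare mass `m > 0`, the Wilson–Dirac matrix `D_W(U, m, 1)` is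
invertible and its inverse has `ℓ²` operator norm `≤ 1/m` (Neumann series, HJL (2.14)). -/
theorem stub_detQuasilocal_propagatorBound :
    ∀ (n : ℕ) [NeZero n] (U : GaugeConfig 4 n SU3) (m : ℝ), 0 < m →
      IsUnit (wilsonDirac (fundamentalRep (Fin 3)) U m 1).det ∧
        ‖(wilsonDirac (fundamentalRep (Fin 3)) U m 1)⁻¹‖ ≤ m⁻¹ :=
  fun _ _ U _ hm => detQL_isUnit_det_wilsonDirac_and_norm_inv_le (fundamentalRep (Fin 3))
    fundamentalRep_mem_unitaryGroup U hm

end Torus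

end Summit.QuantumFields.QCD.Cruxes.WindowExtinction.FreeVolumeHeavyWitness

end
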